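import Mathlib
import Literature.NumberTheory.Transcendental.KZCalculus
import Literature.NumberTheory.Transcendental.KZSemialgebraicComplex
import Literature.NumberTheory.Transcendental.SemialgebraicMapsProofs
import Literature.NumberTheory.Transcendental.KZCalculusProofs
import Literature.NumberTheory.Transcendental.KZIntervalPeriodProofs
import Summits.KontsevichZagierPeriods.KontsevichZagierPeriods.Theses.UnfoldedStokes

/-!
# `HyperellipticRiemannRelation` (stmt-KontsevichZagierPeriods-3522), line `SketchIdeator2`:
# kernel calculus III — the kernels are `ℚ`-semialgebraic functions of the coordinates

Auxiliary file for the registered stub `stub_kernelCalculus`. With `Φ(z) = ∏ⱼ √(z − eⱼ)`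
(rational branch points, principal square roots) and real `ℚ`-semialgebraic coordinate functions
`X, Y` on a set `S ⊆ ℝⁿ`, the real and imaginary parts of
`Φ(X + iY)`, `Σⱼ (X + iY − eⱼ)⁻¹`, of the simplex kernel `(X₁+iY)/(Φ(X₀+iY)Φ(X₁+iY))` and its
`τ`-derivative, and of the one-point kernel `(X+iY)/Φ(X+iY)` and its derivative are
`ℚ`-semialgebraic on `S` (closure of "semialgebraic real and imaginary parts" under `+ − × ⁻¹ √·`,
file `KZSemialgebraicComplex.lean`, Bochnak–Coste–Roy Prop. 2.2.6), as are the coordinate readings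
`w ↦ w 1 − w 0`, `w ↦ w 2/(1 − w 2)`, `w ↦ (1 − w 2)⁻²` and `w ↦ 1/√|P(w 0)|` used by the line,
and the bands `D × [0,1)`, `D × [0,1]` of the engine with the gluing of the `if` along `σ = 1`.
Registered auxiliary stub: `stub_kernelCalculusAux3` (`Φ(X + iY)` has semialgebraic real and
imaginary parts). No definitions.
References: Bochnak–Coste–Roy 1998, §2.2; Kontsevich–Zagier 2001, §1.1.
-/

noncomputable section

namespace Summit.KontsevichZagierPeriods.UnfoldedStokes.HyperellipticRiemannRelationLine

open Set
open Literature.NumberTheory.Transcendental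
open Literature.ModelTheory.ExponentialFields (IsSemialgebraic)

namespace KernelCalculus

variable {n : ℕ} {S : Set (Fin n → ℝ)}

/-! ## Closure properties of "semialgebraic real and imaginary parts" -/

/-- Finite products. [cite: BochnakCosteRoy1998, Prop. 2.2.6] -/
theorem re_im_finsetProd {ι : Type*} (t : Finset ι) {F : ι → (Fin n → ℝ) → ℂ}
    (hS : IsSemialgebraic ℚ S)
    (hF : ∀ i ∈ t, IsSemialgebraicFunOn ℚ S (fun x => (F i x).re) ∧
      IsSemialgebraicFunOn ℚ S (fun x => (F i x).im)) :
    IsSemialgebraicFunOn ℚ S (fun x => (∏ i ∈ t, F i x).re) ∧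
      IsSemialgebraicFunOn ℚ S (fun x => (∏ i ∈ t, F i x).im) := by
  classical
  induction t using Finset.induction_on with
  | empty =>
    exact ⟨by simpa using isSemialgebraicFunOn_natCast (k := ℚ) (R := ℝ) hS 1,
      by simpa using isSemialgebraicFunOn_natCast (k := ℚ) (R := ℝ) hS 0⟩
  | insert a t ha ih =>
    have h := re_im_mul (hF a (Finset.mem_insert_self a t))
      (ih fun i hi => hF i (Finset.mem_insert_of_mem hi))
    refine ⟨h.1.congr fun x _ => ?_, h.2.congr fun x _ => ?_⟩ <;> simp [Finset.prod_insert ha]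

/-- Finite sums. [cite: BochnakCosteRoy1998, Prop. 2.2.6] -/
theorem re_im_finsetSum {ι : Type*} (t : Finset ι) {F : ι → (Fin n → ℝ) → ℂ}
    (hS : IsSemialgebraic ℚ S)
    (hF : ∀ i ∈ t, IsSemialgebraicFunOn ℚ S (fun x => (F i x).re) ∧
      IsSemialgebraicFunOn ℚ S (fun x => (F i x).im)) :
    IsSemialgebraicFunOn ℚ S (fun x => (∑ i ∈ t, F i x).re) ∧
      IsSemialgebraicFunOn ℚ S (fun x => (∑ i ∈ t, F i x).im) := by
  classical
  induction t using Finset.induction_on with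
  | empty =>
    exact ⟨by simpa using isSemialgebraicFunOn_natCast (k := ℚ) (R := ℝ) hS 0,
      by simpa using isSemialgebraicFunOn_natCast (k := ℚ) (R := ℝ) hS 0⟩
  | insert a t ha ih =>
    have h := re_im_add (hF a (Finset.mem_insert_self a t))
      (ih fun i hi => hF i (Finset.mem_insert_of_mem hi))
    refine ⟨h.1.congr fun x _ => ?_, h.2.congr fun x _ => ?_⟩ <;> simp [Finset.sum_insert ha]

/-- Rational constants. [cite: KontsevichZagier2001, §1.1] -/
theorem re_im_ratCast (hS : IsSemialgebraic ℚ S) (q : ℚ) :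
    IsSemialgebraicFunOn ℚ S (fun _ => (((q : ℝ) : ℂ)).re) ∧
      IsSemialgebraicFunOn ℚ S (fun _ => (((q : ℝ) : ℂ)).im) :=
  re_im_const hS (by simpa using isAlgebraic_algebraMap (R := ℚ) (A := ℝ) q)
    (by simpa using isAlgebraic_zero)

/-- The constant `i`. [cite: KontsevichZagier2001, §1.1] -/
theorem re_im_I (hS : IsSemialgebraic ℚ S) :
    IsSemialgebraicFunOn ℚ S (fun _ => (Complex.I).re) ∧
      IsSemialgebraicFunOn ℚ S (fun _ => (Complex.I).im) :=
  re_im_const hS (by simpa using isAlgebraic_zero) (by simpa using isAlgebraic_one)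

/-- Natural-number constants. [cite: KontsevichZagier2001, §1.1] -/
theorem re_im_natCast (hS : IsSemialgebraic ℚ S) (j : ℕ) :
    IsSemialgebraicFunOn ℚ S (fun _ => (j : ℂ).re) ∧
      IsSemialgebraicFunOn ℚ S (fun _ => (j : ℂ).im) :=
  re_im_const hS (by simpa using isAlgebraic_algebraMap (R := ℚ) (A := ℝ) j)
    (by simpa using isAlgebraic_zero)

/-- The point `X + iY` of two real semialgebraic coordinates. [cite: BochnakCosteRoy1998, §2.2] -/
theorem re_im_lin {X Y : (Fin n → ℝ) → ℝ} (hX : IsSemialgebraicFunOn ℚ S X)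
    (hY : IsSemialgebraicFunOn ℚ S Y) :
    IsSemialgebraicFunOn ℚ S (fun w => ((X w : ℂ) + (Y w : ℂ) * Complex.I).re) ∧
      IsSemialgebraicFunOn ℚ S (fun w => ((X w : ℂ) + (Y w : ℂ) * Complex.I).im) := by
  have hS : IsSemialgebraic ℚ S := IsSemialgebraicFunOn.isSemialgebraic_holds hX
  exact re_im_add (re_im_ofReal hS hX) (re_im_mul (re_im_ofReal hS hY) (re_im_I hS))

/-! ## The function `Φ` and the kernels read through semialgebraic coordinates -/

section Phi

variable {e : Fin 5 → ℚ} {Φ : ℂ → ℂ}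
  (hΦ : ∀ z, Φ z = ∏ j : Fin 5, Complex.sqrt (z - ((e j : ℝ) : ℂ)))

/-- `Σⱼ (X + iY − eⱼ)⁻¹` has semialgebraic real and imaginary parts off the branch points.
[cite: BochnakCosteRoy1998, Prop. 2.2.6] -/
theorem re_im_sumInv_lin {X Y : (Fin n → ℝ) → ℝ} (hX : IsSemialgebraicFunOn ℚ S X)
    (hY : IsSemialgebraicFunOn ℚ S Y)
    (hne : ∀ w ∈ S, ∀ j, (X w : ℂ) + (Y w : ℂ) * Complex.I ≠ ((e j : ℝ) : ℂ)) :
    IsSemialgebraicFunOn ℚ S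
        (fun w => (∑ j : Fin 5, ((X w : ℂ) + (Y w : ℂ) * Complex.I - ((e j : ℝ) : ℂ))⁻¹).re) ∧
      IsSemialgebraicFunOn ℚ S
        (fun w => (∑ j : Fin 5, ((X w : ℂ) + (Y w : ℂ) * Complex.I - ((e j : ℝ) : ℂ))⁻¹).im) := by
  have hS : IsSemialgebraic ℚ S := IsSemialgebraicFunOn.isSemialgebraic_holds hX
  exact re_im_finsetSum _ hS fun j _ =>
    re_im_inv (re_im_sub (re_im_lin hX hY) (re_im_ratCast hS (e j))) fun w hw =>
      sub_ne_zero.2 (hne w hw j)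

include hΦ

/-- `Φ(z) ≠ 0` off the branch points (`√u = 0 ↔ u = 0`). [folklore] -/
theorem Phi_ne_zero_of_ne_branch {z : ℂ} (hz : ∀ j, z ≠ ((e j : ℝ) : ℂ)) : Φ z ≠ 0 := by
  rw [hΦ, Finset.prod_ne_zero_iff]
  intro j _ h
  rw [Complex.sqrt, Complex.cpow_eq_zero_iff] at h
  exact sub_ne_zero.2 (hz j) h.1

/-- **`Φ(X + iY)` has semialgebraic real and imaginary parts** (five square roots and a product).
[cite: BochnakCosteRoy1998, Prop. 2.2.6] -/
theorem re_im_Phi_lin {X Y : (Fin n → ℝ) → ℝ} (hX : IsSemialgebraicFunOn ℚ S X)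
    (hY : IsSemialgebraicFunOn ℚ S Y) :
    IsSemialgebraicFunOn ℚ S (fun w => (Φ ((X w : ℂ) + (Y w : ℂ) * Complex.I)).re) ∧
      IsSemialgebraicFunOn ℚ S (fun w => (Φ ((X w : ℂ) + (Y w : ℂ) * Complex.I)).im) := by
  have hS : IsSemialgebraic ℚ S := IsSemialgebraicFunOn.isSemialgebraic_holds hX
  simp only [hΦ]
  exact re_im_finsetProd _ hS fun j _ =>
    re_im_sqrt (re_im_sub (re_im_lin hX hY) (re_im_ratCast hS (e j)))

/-- **The simplex kernel** `(X₁+iY)/(Φ(X₀+iY)Φ(X₁+iY))` has semialgebraic real and imaginary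
parts where both points are off the branch points. [cite: BochnakCosteRoy1998, Prop. 2.2.6] -/
theorem re_im_pairK {X₀ X₁ Y : (Fin n → ℝ) → ℝ} (hX₀ : IsSemialgebraicFunOn ℚ S X₀)
    (hX₁ : IsSemialgebraicFunOn ℚ S X₁) (hY : IsSemialgebraicFunOn ℚ S Y)
    (hne₀ : ∀ w ∈ S, ∀ j, (X₀ w : ℂ) + (Y w : ℂ) * Complex.I ≠ ((e j : ℝ) : ℂ))
    (hne₁ : ∀ w ∈ S, ∀ j, (X₁ w : ℂ) + (Y w : ℂ) * Complex.I ≠ ((e j : ℝ) : ℂ)) :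
    IsSemialgebraicFunOn ℚ S (fun w => (((X₁ w : ℂ) + (Y w : ℂ) * Complex.I) /
        (Φ ((X₀ w : ℂ) + (Y w : ℂ) * Complex.I) * Φ ((X₁ w : ℂ) + (Y w : ℂ) * Complex.I))).re) ∧
      IsSemialgebraicFunOn ℚ S (fun w => (((X₁ w : ℂ) + (Y w : ℂ) * Complex.I) /
        (Φ ((X₀ w : ℂ) + (Y w : ℂ) * Complex.I) * Φ ((X₁ w : ℂ) + (Y w : ℂ) * Complex.I))).im) :=
  re_im_div (re_im_lin hX₁ hY) (re_im_mul (re_im_Phi_lin hΦ hX₀ hY) (re_im_Phi_lin hΦ hX₁ hY))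
    fun w hw => mul_ne_zero (Phi_ne_zero_of_ne_branch hΦ (hne₀ w hw))
      (Phi_ne_zero_of_ne_branch hΦ (hne₁ w hw))

/-- **The `τ`-derivative of the simplex kernel**
`(1 − ((X₁+iY)/2) Σⱼ ((X₀+iY−eⱼ)⁻¹ + (X₁+iY−eⱼ)⁻¹))/(Φ(X₀+iY)Φ(X₁+iY))` has semialgebraic real
and imaginary parts off the branch points. [cite: BochnakCosteRoy1998, Prop. 2.2.6] -/
theorem re_im_pairK' {X₀ X₁ Y : (Fin n → ℝ) → ℝ} (hX₀ : IsSemialgebraicFunOn ℚ S X₀)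
    (hX₁ : IsSemialgebraicFunOn ℚ S X₁) (hY : IsSemialgebraicFunOn ℚ S Y)
    (hne₀ : ∀ w ∈ S, ∀ j, (X₀ w : ℂ) + (Y w : ℂ) * Complex.I ≠ ((e j : ℝ) : ℂ))
    (hne₁ : ∀ w ∈ S, ∀ j, (X₁ w : ℂ) + (Y w : ℂ) * Complex.I ≠ ((e j : ℝ) : ℂ)) :
    IsSemialgebraicFunOn ℚ S (fun w =>
        ((1 - ((X₁ w : ℂ) + (Y w : ℂ) * Complex.I) / 2 *
          ∑ j : Fin 5, (((X₀ w : ℂ) + (Y w : ℂ) * Complex.I - ((e j : ℝ) : ℂ))⁻¹ +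
            ((X₁ w : ℂ) + (Y w : ℂ) * Complex.I - ((e j : ℝ) : ℂ))⁻¹)) /
        (Φ ((X₀ w : ℂ) + (Y w : ℂ) * Complex.I) * Φ ((X₁ w : ℂ) + (Y w : ℂ) * Complex.I))).re) ∧
      IsSemialgebraicFunOn ℚ S (fun w =>
        ((1 - ((X₁ w : ℂ) + (Y w : ℂ) * Complex.I) / 2 *
          ∑ j : Fin 5, (((X₀ w : ℂ) + (Y w : ℂ) * Complex.I - ((e j : ℝ) : ℂ))⁻¹ +
            ((X₁ w : ℂ) + (Y w : ℂ) * Complex.I - ((e j : ℝ) : ℂ))⁻¹)) /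
        (Φ ((X₀ w : ℂ) + (Y w : ℂ) * Complex.I) * Φ ((X₁ w : ℂ) + (Y w : ℂ) * Complex.I))).im) := by
  have hS : IsSemialgebraic ℚ S := IsSemialgebraicFunOn.isSemialgebraic_holds hY
  have hsum : IsSemialgebraicFunOn ℚ S (fun w =>
        (∑ j : Fin 5, (((X₀ w : ℂ) + (Y w : ℂ) * Complex.I - ((e j : ℝ) : ℂ))⁻¹ +
            ((X₁ w : ℂ) + (Y w : ℂ) * Complex.I - ((e j : ℝ) : ℂ))⁻¹)).re) ∧
      IsSemialgebraicFunOn ℚ S (fun w =>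
        (∑ j : Fin 5, (((X₀ w : ℂ) + (Y w : ℂ) * Complex.I - ((e j : ℝ) : ℂ))⁻¹ +
            ((X₁ w : ℂ) + (Y w : ℂ) * Complex.I - ((e j : ℝ) : ℂ))⁻¹)).im) :=
    re_im_finsetSum _ hS fun j _ => re_im_add
      (re_im_inv (re_im_sub (re_im_lin hX₀ hY) (re_im_ratCast hS (e j))) fun w hw =>
        sub_ne_zero.2 (hne₀ w hw j))
      (re_im_inv (re_im_sub (re_im_lin hX₁ hY) (re_im_ratCast hS (e j))) fun w hw =>
        sub_ne_zero.2 (hne₁ w hw j))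
  exact re_im_div (re_im_sub (re_im_natCast hS 1 |>.imp (fun h => h.congr fun _ _ => by simp)
      (fun h => h.congr fun _ _ => by simp))
    (re_im_mul (re_im_div (re_im_lin hX₁ hY) (re_im_natCast hS 2) fun _ _ => by norm_num) hsum))
    (re_im_mul (re_im_Phi_lin hΦ hX₀ hY) (re_im_Phi_lin hΦ hX₁ hY))
    fun w hw => mul_ne_zero (Phi_ne_zero_of_ne_branch hΦ (hne₀ w hw))
      (Phi_ne_zero_of_ne_branch hΦ (hne₁ w hw))

/-- **The one-point kernel** `(X+iY)/Φ(X+iY)` has semialgebraic real and imaginary parts off the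
branch points. [cite: BochnakCosteRoy1998, Prop. 2.2.6] -/
theorem re_im_singlek {X Y : (Fin n → ℝ) → ℝ} (hX : IsSemialgebraicFunOn ℚ S X)
    (hY : IsSemialgebraicFunOn ℚ S Y)
    (hne : ∀ w ∈ S, ∀ j, (X w : ℂ) + (Y w : ℂ) * Complex.I ≠ ((e j : ℝ) : ℂ)) :
    IsSemialgebraicFunOn ℚ S (fun w => (((X w : ℂ) + (Y w : ℂ) * Complex.I) /
        Φ ((X w : ℂ) + (Y w : ℂ) * Complex.I)).re) ∧
      IsSemialgebraicFunOn ℚ S (fun w => (((X w : ℂ) + (Y w : ℂ) * Complex.I) /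
        Φ ((X w : ℂ) + (Y w : ℂ) * Complex.I)).im) :=
  re_im_div (re_im_lin hX hY) (re_im_Phi_lin hΦ hX hY) fun w hw =>
    Phi_ne_zero_of_ne_branch hΦ (hne w hw)

/-- **The derivative of the one-point kernel** `(1 − ((X+iY)/2) Σⱼ (X+iY−eⱼ)⁻¹)/Φ(X+iY)` has
semialgebraic real and imaginary parts off the branch points.
[cite: BochnakCosteRoy1998, Prop. 2.2.6] -/
theorem re_im_singlek' {X Y : (Fin n → ℝ) → ℝ} (hX : IsSemialgebraicFunOn ℚ S X)
    (hY : IsSemialgebraicFunOn ℚ S Y)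
    (hne : ∀ w ∈ S, ∀ j, (X w : ℂ) + (Y w : ℂ) * Complex.I ≠ ((e j : ℝ) : ℂ)) :
    IsSemialgebraicFunOn ℚ S (fun w => ((1 - ((X w : ℂ) + (Y w : ℂ) * Complex.I) / 2 *
        ∑ j : Fin 5, ((X w : ℂ) + (Y w : ℂ) * Complex.I - ((e j : ℝ) : ℂ))⁻¹) /
        Φ ((X w : ℂ) + (Y w : ℂ) * Complex.I)).re) ∧
      IsSemialgebraicFunOn ℚ S (fun w => ((1 - ((X w : ℂ) + (Y w : ℂ) * Complex.I) / 2 *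
        ∑ j : Fin 5, ((X w : ℂ) + (Y w : ℂ) * Complex.I - ((e j : ℝ) : ℂ))⁻¹) /
        Φ ((X w : ℂ) + (Y w : ℂ) * Complex.I)).im) := by
  have hS : IsSemialgebraic ℚ S := IsSemialgebraicFunOn.isSemialgebraic_holds hY
  exact re_im_div (re_im_sub (re_im_natCast hS 1 |>.imp (fun h => h.congr fun _ _ => by simp)
      (fun h => h.congr fun _ _ => by simp))
    (re_im_mul (re_im_div (re_im_lin hX hY) (re_im_natCast hS 2) fun _ _ => by norm_num)
      (re_im_sumInv_lin hX hY hne)))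
    (re_im_Phi_lin hΦ hX hY) fun w hw => Phi_ne_zero_of_ne_branch hΦ (hne w hw)

end Phi

/-! ## Coordinate functions on `ℝ³` -/

/-- `w ↦ w 1 − w 0` is `ℚ`-semialgebraic. [cite: BochnakCosteRoy1998, §2.2] -/
theorem isSemialgebraicFunOn_sub_coord {S : Set (Fin 3 → ℝ)} (hS : IsSemialgebraic ℚ S) :
    IsSemialgebraicFunOn ℚ S (fun w => w 1 - w 0) :=
  (isSemialgebraicFunOn_aeval hS (MvPolynomial.X 1 - MvPolynomial.X 0)).congr fun w _ => by simp

/-- The height `w ↦ w 2/(1 − w 2)` is `ℚ`-semialgebraic off `w 2 = 1`.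
[cite: BochnakCosteRoy1998, §2.2] -/
theorem isSemialgebraicFunOn_height {S : Set (Fin 3 → ℝ)} (hS : IsSemialgebraic ℚ S)
    (h1 : ∀ w ∈ S, w 2 ≠ 1) : IsSemialgebraicFunOn ℚ S (fun w => w 2 / (1 - w 2)) := by
  refine (isSemialgebraicFunOn_aeval_div_aeval hS (MvPolynomial.X 2) (1 - MvPolynomial.X 2)
    fun w hw => ?_).congr fun w _ => by simp
  simpa [sub_eq_zero] using (h1 w hw).symm

/-- The Jacobian `w ↦ (1 − w 2)⁻²` of the height is `ℚ`-semialgebraic off `w 2 = 1`.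
[cite: BochnakCosteRoy1998, §2.2] -/
theorem isSemialgebraicFunOn_heightDeriv {S : Set (Fin 3 → ℝ)} (hS : IsSemialgebraic ℚ S)
    (h1 : ∀ w ∈ S, w 2 ≠ 1) : IsSemialgebraicFunOn ℚ S (fun w => 1 / (1 - w 2) ^ 2) := by
  refine (isSemialgebraicFunOn_aeval_div_aeval hS 1 ((1 - MvPolynomial.X 2) ^ 2)
    fun w hw => ?_).congr fun w _ => by simp
  have : (1 : ℝ) - w 2 ≠ 0 := sub_ne_zero.2 (h1 w hw).symm
  simpa using this

/-- The frozen amplitude `w ↦ ρ(w 0) = 1/√|P(w 0)|`, `P = ∏ᵢ (· − eᵢ)`, is `ℚ`-semialgebraic where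
`w 0` is off the branch points. [cite: BochnakCosteRoy1998, Prop. 2.2.6] -/
theorem isSemialgebraicFunOn_rho {e : Fin 5 → ℚ} {ρ : ℝ → ℝ}
    (hρ : ∀ t, ρ t = 1 / Real.sqrt |∏ i : Fin 5, (t - (e i : ℝ))|)
    {S : Set (Fin 3 → ℝ)} (hS : IsSemialgebraic ℚ S) (h0 : ∀ w ∈ S, ∀ j, w 0 ≠ (e j : ℝ)) :
    IsSemialgebraicFunOn ℚ S (fun w => ρ (w 0)) := by
  have hP : IsSemialgebraicFunOn ℚ S (fun w => ∏ i : Fin 5, (w 0 - (e i : ℝ))) :=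
    (isSemialgebraicFunOn_aeval hS (∏ i : Fin 5, (MvPolynomial.X 0 - MvPolynomial.C (e i)))).congr
      fun w _ => by simp
  have h := (IsSemialgebraicFunOn.sqrt_holds hP.abs).inv fun w hw => ?_
  · refine h.congr fun w _ => ?_
    simp [hρ]
  · rw [Real.sqrt_ne_zero']
    exact abs_pos.2 (Finset.prod_ne_zero_iff.2 fun j _ => sub_ne_zero.2 (h0 w hw j))

/-! ## The bands of the engine over a base `D ⊆ ℝ²` -/

/-- The cylinder `{w | (w 0, w 1) ∈ D}` over a `ℚ`-semialgebraic `D ⊆ ℝ²` is `ℚ`-semialgebraic.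
[cite: BochnakCosteRoy1998, §2.2] -/
theorem isSemialgebraic_cyl3 {D : Set (Fin 2 → ℝ)} (hD : IsSemialgebraic ℚ D) :
    IsSemialgebraic ℚ {w : Fin 3 → ℝ | (![w 0, w 1] : Fin 2 → ℝ) ∈ D} := by
  convert hD.preimage_comp (![0, 1] : Fin 2 → Fin 3) using 1
  ext w
  simp only [mem_setOf_eq, mem_preimage]
  have : (![w 0, w 1] : Fin 2 → ℝ) = w ∘ (![0, 1] : Fin 2 → Fin 3) := by
    ext i; fin_cases i <;> rfl
  rw [this]

/-- The half-open band `D × [0,1)`. [cite: BochnakCosteRoy1998, §2.2] -/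
theorem isSemialgebraic_band_lt {D : Set (Fin 2 → ℝ)} (hD : IsSemialgebraic ℚ D) :
    IsSemialgebraic ℚ {w : Fin 3 → ℝ | (![w 0, w 1] : Fin 2 → ℝ) ∈ D ∧ 0 ≤ w 2 ∧ w 2 < 1} := by
  have h2 := Literature.ModelTheory.ExponentialFields.isSemialgebraic_setOf_eval_nonneg (k := ℚ)
    (R := ℝ) (MvPolynomial.X 2 : MvPolynomial (Fin 3) ℚ)
  have h3 := Literature.ModelTheory.ExponentialFields.isSemialgebraic_setOf_eval_lt (k := ℚ)
    (R := ℝ) (MvPolynomial.X 2 : MvPolynomial (Fin 3) ℚ) 1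
  simp only [MvPolynomial.aeval_X, map_one] at h2 h3
  exact (isSemialgebraic_cyl3 hD).inter (h2.inter h3)

/-- The closed band `D × [0,1]`. [cite: BochnakCosteRoy1998, §2.2] -/
theorem isSemialgebraic_band_le {D : Set (Fin 2 → ℝ)} (hD : IsSemialgebraic ℚ D) :
    IsSemialgebraic ℚ {w : Fin 3 → ℝ | (![w 0, w 1] : Fin 2 → ℝ) ∈ D ∧ 0 ≤ w 2 ∧ w 2 ≤ 1} := by
  have h2 := Literature.ModelTheory.ExponentialFields.isSemialgebraic_setOf_eval_nonneg (k := ℚ)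
    (R := ℝ) (MvPolynomial.X 2 : MvPolynomial (Fin 3) ℚ)
  have h3 := Literature.ModelTheory.ExponentialFields.isSemialgebraic_setOf_eval_le (k := ℚ)
    (R := ℝ) (MvPolynomial.X 2 : MvPolynomial (Fin 3) ℚ) 1
  simp only [MvPolynomial.aeval_X, map_one] at h2 h3
  exact (isSemialgebraic_cyl3 hD).inter (h2.inter h3)

/-- The top face `{w 2 = 1}`. [cite: BochnakCosteRoy1998, §2.2] -/
theorem isSemialgebraic_top : IsSemialgebraic ℚ {w : Fin 3 → ℝ | w 2 = 1} := by
  have h := Literature.ModelTheory.ExponentialFields.isSemialgebraic_setOf_eval_eq_zero (k := ℚ)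
    (R := ℝ) (MvPolynomial.X 2 - 1 : MvPolynomial (Fin 3) ℚ)
  simp only [map_sub, MvPolynomial.aeval_X, map_one, sub_eq_zero] at h
  exact h

/-- **Gluing the height primitive with zero on the top face.** If `V = G` below `w 2 = 1` and
`V = 0` at `w 2 = 1` (an `if`), and `G` is `ℚ`-semialgebraic on the half-open band, then `V` is
`ℚ`-semialgebraic on the closed band. [cite: BochnakCosteRoy1998, Def. 2.2.5] -/
theorem isSemialgebraicFunOn_ite {D : Set (Fin 2 → ℝ)} (hD : IsSemialgebraic ℚ D)
    {V G : (Fin 3 → ℝ) → ℝ} (hV : ∀ w, V w = if w 2 < 1 then G w else 0)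
    (hG : IsSemialgebraicFunOn ℚ
      {w : Fin 3 → ℝ | (![w 0, w 1] : Fin 2 → ℝ) ∈ D ∧ 0 ≤ w 2 ∧ w 2 < 1} G) :
    IsSemialgebraicFunOn ℚ
      {w : Fin 3 → ℝ | (![w 0, w 1] : Fin 2 → ℝ) ∈ D ∧ 0 ≤ w 2 ∧ w 2 ≤ 1} V := by
  have h0 : IsSemialgebraicFunOn ℚ {w : Fin 3 → ℝ | w 2 = 1} (fun _ => (0:ℝ)) := by
    simpa using isSemialgebraicFunOn_natCast (k := ℚ) (R := ℝ) isSemialgebraic_top 0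
  have hU := IsSemialgebraicFunOn.union (F := V) hG h0 (fun w hw => by rw [hV, if_pos hw.2.2])
    (fun w hw => by rw [hV, if_neg (not_lt.2 (le_of_eq (Eq.symm hw)))])
  refine hU.mono (fun w hw => ?_) (isSemialgebraic_band_le hD)
  rcases lt_or_eq_of_le hw.2.2 with h | h
  · exact Or.inl ⟨hw.1, hw.2.1, h⟩
  · exact Or.inr h

end KernelCalculus

/-! ## Registered auxiliary stub: `Φ(X + iY)` is semialgebraic in real coordinates -/

/-- **`Φ(X + iY)` has `ℚ`-semialgebraic real and imaginary parts.** For rational branch points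
`e`, `Φ(z) = ∏ⱼ √(z − eⱼ)` (principal square roots) and real `ℚ`-semialgebraic functions `X, Y`
on `S ⊆ ℝⁿ`, the functions `re Φ(X + iY)` and `im Φ(X + iY)` are `ℚ`-semialgebraic on `S`
(`re √u = √((|u|+re u)/2)`, `im √u = ±√((|u|−re u)/2)` by the sign of `im u`; graph
elimination). [cite: BochnakCosteRoy1998, Prop. 2.2.6] -/
theorem stub_kernelCalculusAux3 : ∀ (e : Fin 5 → ℚ) (Φ : ℂ → ℂ), (∀ z, Φ z = ∏ j : Fin 5,
    Complex.sqrt (z - ((e j : ℝ) : ℂ))) → ∀ (n : ℕ) (S : Set (Fin n → ℝ))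
    (X Y : (Fin n → ℝ) → ℝ), IsSemialgebraicFunOn ℚ S X → IsSemialgebraicFunOn ℚ S Y →
    IsSemialgebraicFunOn ℚ S (fun w => (Φ ((X w : ℂ) + (Y w : ℂ) * Complex.I)).re) ∧
    IsSemialgebraicFunOn ℚ S (fun w => (Φ ((X w : ℂ) + (Y w : ℂ) * Complex.I)).im) := by
  intro e Φ hΦ n S X Y hX hY
  exact KernelCalculus.re_im_Phi_lin hΦ hX hY

end Summit.KontsevichZagierPeriods.UnfoldedStokes.HyperellipticRiemannRelationLine
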